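import Summits.AtomisticToContinuum.BoseEinsteinCondensation.Theses.BECRieszReverseHolder
import HarnessLib.Audit

/-!
# Birth skeleton for crux `BECRieszReverseHolder.CoarseGrainedReverseHolder`
(item stmt-AtomisticToContinuum-12840, rank 2, route route-AtomisticToContinuum-BECRieszReverseHolder;
skeleton registrar planner-skel-stmt-AtomisticToContinuum-12840-0, 2026-08-17)

Crux (fixed, by name): for admissible `v`, small `ρ`, every resolution `ℓ > 0` there is `C` with, eventually in
`N = n+1`, some `δ > 0` such that EVERY non-negative `δ`-near-minimiser `Ψ` of the Dirichlet energy in the box of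
side `L = (N/ρ)^{1/3}` has coarse-grained reverse-Hölder functional
`F_{n,ℓ}(Ψ) := m³ ∫dX̂ Σ_Q (∫_Q Ψ(y,X̂)² dy)² / ∫ Ψ(y,X̂)² dy ≤ C` (`m = ⌊L/ℓ⌋`, cubes `Q` of side `L/m`).

Line of this skeleton = (reduction to ONE reference state) ∘ (the route's shadow mechanism):

* `stub_sliceFunctionalLipschitz` (S1, provable now, size M): `F_{n,ℓ}` is `L²`-Lipschitz modulo a phase,
  `F(Ψ) ≤ F(Φ) + 6m³‖Ψ − cΦ‖₂` (refuter g45-9's structural fact: `f(w,M) = |w|₂²/M` has partials in `[−1,2]` on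
  `{0 ≤ Σw ≤ M}`, then `‖|Ψ|²−|Φ|²‖₁ ≤ 2‖Ψ − cΦ‖₂`; Fubini along `Matrix.vecCons`).
* `stub_groundStateRigidity` (S2 = route item stmt-AtomisticToContinuum-9072 `GroundStateRigidity`, BY NAME):
  `δ`-near-minimisers at fixed large `N` are `η`-close in `L²` up to a phase, `η` chosen after `N`.
* `stub_shadowDominationReference` (S3, the open content, HARDEST): Bose–Riesz membership for ONE positive
  `δ`-near-minimiser per `δ` — its functional is dominated by `A·(1 + S_n)`, `S_n` the supremum over `y` of the
  `θ = 2` cavity-field exponential moment of the shadow smeared Riesz-2 gas in the Bose dictionary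
  (`b = 2π^{-3/2}(a/ρ)^{1/2}`, `η = max((8πρa)^{-1/2}, ρ^{-1/3})`, kernel and Hamiltonian verbatim those of
  `RieszShadowFieldMoment` / `coarseGrainedReverseHolder_of_fieldMomentDomination`; the dictionary is bound by
  `∀ x, x = … →` equations as in `RieszShadowFieldMoment`, not by `let`, so that registered signatures survive). Strictly weaker than the typed
  `∀Ψ` candidate for the informal item `BoseRieszMembership` (stmt-AtomisticToContinuum-12602): the reference state
  may be chosen (e.g. a wall-cut-off of the true ground state `Ψ₀`, which solves `HΨ₀ = E₀Ψ₀` and has a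
  Feynman–Kac representation — near-minimisers solve nothing), which is the why-easier of the reduction.
* `stub_shadowMomentBoseCorner` (S4, the classical engine where the line uses it): `S_n ≤ C` eventually in `n`
  for small `ρ`. Strictly weaker than route item stmt-AtomisticToContinuum-12841 `RieszShadowFieldMoment` (only
  `θ = 2`, only the dictionary's one-parameter corner `(b, η)(ρ, a)`); it follows from that item by the corner
  arithmetic already kernel-checked inside `coarseGrainedReverseHolder_of_fieldMomentDomination`
  (Theorems/BECRieszReverseHolderBoseRieszMembershipGlue.lean, the `a = 0` / `a > 0` split, Kac corner
  `ρξ³ ≥ 2`, coupling corner `2π^{-3/2}a^{1/2}ρ^{1/6} < Γ₀`, `η ≤ L` eventually).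

Composition: `def BirthImplication : Prop := S1 → S2 → S3 → S4 → CoarseGrainedReverseHolder` is PROVED sorry-free
(`birthImplication_holds`, axioms propext / Classical.choice / Quot.sound; every stub load-bearing) and the
registered skeleton theorem `CoarseGrainedReverseHolder_of : CoarseGrainedReverseHolder` applies it to the four
`stub_*` (the A12 shape: concludes the crux BY NAME, no hypotheses, sorries only inside stubs). The glue: `ρ₀ := min`, `C' := max A 0 · (1 + max C 0) + 1`; at each large `n`: `η₀ := 1/(6m³+6)`,
`δ` from rigidity at tolerance `η₀²`, the reference state `Φ` from S3 at that `δ` has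
`F(Φ) ≤ A(1+S_n) ≤ max A 0 · (1 + max C 0)` by S4, and every non-negative `δ`-near-minimiser `Ψ` is
`η₀`-close to `Φ` up to a phase (S2), so `F(Ψ) ≤ F(Φ) + 6m³η₀ ≤ F(Φ) + 1` (S1).

Disproof used: none exists for this crux (`ledger crux ls`: no Disproof.lean, no Negative/ lemmas, 2026-08-17);
negatives index has no statement on slice functionals. Nearest tree facts: the two glue theorems of
Theorems/BECRieszReverseHolderBoseRieszMembershipGlue.lean (used only in docstrings here — the skeleton re-cuts
their `∀Ψ` hypothesis into S2+S1+S3 and their `RieszShadowFieldMoment` hypothesis into S4).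
-/

noncomputable section

open MeasureTheory Filter Matrix
open scoped ENNReal NNReal BigOperators

namespace Summit.AtomisticToContinuum.BoseEinsteinCondensation.Cruxes.CoarseGrainedReverseHolder.Birth

open Literature.MathematicalPhysics.QuantumManyBody
open Summit.AtomisticToContinuum.BoseEinsteinCondensation.Theses.BECRieszReverseHolder

set_option linter.unusedVariables false

/-! ## Stubs (`sorry` only here) -/

/-- **S1 — the coarse RH₂ slice functional is `L²`-Lipschitz modulo a phase** (provable now, size M).
For trial states `Ψ, Φ` of `n+1` bosons in a box of side `L`, a unit complex `c` and `‖Ψ − cΦ‖₂ ≤ η`: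
`F_{n,ℓ}(Ψ) ≤ F_{n,ℓ}(Φ) + 6 m³ η`, `m = ⌊L/ℓ⌋`. Proof plan: pointwise in the environment `X̂`, with cube
masses `w_Q` and slice mass `M ≥ Σ_Q w_Q` (cubes tile `[0,L)³ ⊇` box, disjoint), the function
`f(w, M) = Σ_Q w_Q²/M` (`0/0 = 0`) satisfies `|f(w,M) − f(w',M')| ≤ 2Σ|w_Q − w'_Q| + |M − M'|` (partials
`2w_Q/M ∈ [0,2]`, `−Σw²/M² ∈ [−1,0]` on the convex domain, `f ≤ M` for continuity at `M = 0`); both terms are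
`≤ ∫ ||Ψ|² − |Φ|²|(y,X̂) dy`; integrate in `X̂` (Fubini along `Matrix.vecCons`, `MeasureTheory.volume_preserving`
of `Fin.consEquiv`/`MeasurableEquiv.piFinSuccAbove`) and use
`‖|Ψ|²−|Φ|²‖₁ ≤ ‖|Ψ|−|Φ|‖₂ ‖|Ψ|+|Φ|‖₂ ≤ 2‖Ψ − cΦ‖₂` (`||Ψ|−|Φ|| ≤ |Ψ − cΦ|` for `|c| = 1`, norms one).
No positivity and no sign of `L, ℓ` needed (`m = 0` makes both sides `0`; `M = ⊤` only on a null set since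
`∫M = 1`). Leans on: `BoseGas.TrialState.norm_eq`, `MeasureTheory.lintegral_mono`, `ENNReal.lintegral_mul_le_Lp_mul_Lq`
(Cauchy–Schwarz), Theorems/BECRieszReverseHolderCoarseRH2Toolkit.lean (`setOf_forall_mem_Ico_eq_subCell`,
`natCast_pow_mul_sum_sq_setLIntegral_subCell_le`). -/
theorem stub_sliceFunctionalLipschitz :
    ∀ (n : ℕ) (L ℓ η : ℝ), 0 ≤ η →
    ∀ (Ψ Φ : BoseGas.TrialState (n + 1) L) (c : ℂ), ‖c‖ = 1 →
      ∫⁻ X, (‖Ψ.ψ X - c * Φ.ψ X‖₊ : ENNReal) ^ 2 ≤ ENNReal.ofReal (η ^ 2) →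
      ∀ (m : ℕ), m = ⌊L / ℓ⌋₊ →
      (m : ENNReal) ^ 3 * ∫⁻ X : Fin n → EuclideanSpace ℝ (Fin 3),
          ((∑ k : Fin 3 → Fin m,
              (∫⁻ y in {y : EuclideanSpace ℝ (Fin 3) |
                  ∀ i, y i ∈ Set.Ico ((k i : ℝ) * (L / m)) (((k i : ℝ) + 1) * (L / m))},
                (‖Ψ.ψ (Matrix.vecCons y X)‖₊ : ENNReal) ^ 2) ^ 2) /
            (∫⁻ y, (‖Ψ.ψ (Matrix.vecCons y X)‖₊ : ENNReal) ^ 2))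
        ≤ ((m : ENNReal) ^ 3 * ∫⁻ X : Fin n → EuclideanSpace ℝ (Fin 3),
              ((∑ k : Fin 3 → Fin m,
                  (∫⁻ y in {y : EuclideanSpace ℝ (Fin 3) |
                      ∀ i, y i ∈ Set.Ico ((k i : ℝ) * (L / m)) (((k i : ℝ) + 1) * (L / m))},
                    (‖Φ.ψ (Matrix.vecCons y X)‖₊ : ENNReal) ^ 2) ^ 2) /
                (∫⁻ y, (‖Φ.ψ (Matrix.vecCons y X)‖₊ : ENNReal) ^ 2)))
          + ENNReal.ofReal (6 * (m : ℝ) ^ 3 * η) := by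
  sorry

/-- **S2 — phase rigidity of near-minimisers at fixed `N`** = route item stmt-AtomisticToContinuum-9072
`GroundStateRigidity`, consumed BY NAME (shared with BECPalmLandscape; difficulty M; its own stub programme lives in
Theorems/BECCutLineWeakDisorderGroundStateRigidity*.lean). -/
theorem stub_groundStateRigidity : GroundStateRigidity := by
  sorry

/-- **S3 — shadow domination for a reference state (Bose–Riesz membership of ONE positive near-minimiser per `δ`;
the open content of the crux, HARDEST).** For admissible `v`, small `ρ`, every `ℓ > 0` there is `A` such that
eventually in `n`, for every `δ > 0` SOME non-negative `δ`-near-minimiser `Φ` of `n+1` bosons in the box of side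
`L = ((n+1)/ρ)^{1/3}` has `F_{n,ℓ}(Φ) ≤ A · (1 + S_n)`, where
`S_n = sup_y ∫_{cell^n} e^{−bH − 2b h_X(y)} / ∫_{cell^n} e^{−bH}` is the `θ = 2` cavity-field exponential moment of
the shadow smeared Riesz-2 gas (`g = g_{η,L}` the heat-kernel-subordinated zero-mean periodic Riesz kernel of exponent
2, `H = Σ_{i<j} g(X_i − X_j)`, `h_X(y) = Σ_j g(y − X_j)`) in the Bose dictionary `a = scatteringLength v`,
`b = 2π^{-3/2}(a/ρ)^{1/2}`, `η = max((8πρa)^{-1/2}, ρ^{-1/3})`. Intended proof (card riesz-dtn-trace-bmo-landscape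
R1; route TWO-LAYER PLAN): take `Φ` = a `C¹` wall cut-off of the Dirichlet ground state `Ψ₀` (energy cost `→ 0`, so
`δ`-near for every `δ` at fixed `n`); compare the slices `Ψ₀(·,X̂)²` with the tilted shadow slices `e^{−b h_X̂}`
beyond the healing length through the Feynman–Kac / Jastrow–shadow representation of `Ψ₀` (Reatto–Chester tail
`u(r) = b/r²`), Jensen twice (`⨍_cell h = 0`: Theorems/BECRieszReverseHolderShadowCavityField.lean
`integral_cell_cavityField_eq_zero`, `coarseRH2_shadowSlice_le`) and Hölder in the change of measure; the
microscale (`< η`) factor of the slice only changes `A`. Why it might fail: a many-body infrared term in `−log Ψ₀`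
beyond the pair tail (Literature.Barriers.AtomisticToContinuum.BogoliubovPerturbationInfrared) or void statistics of
`|Ψ₀|²` fatter than the shadow's would break domination by the `θ = 2` moment at large scales. Weaker than the typed
`∀Ψ` candidate `hM` of `coarseGrainedReverseHolder_of_fieldMomentDomination` (which the crux implies outright,
`fieldMomentDomination_of_coarseGrainedReverseHolder`): here `∀ δ ∃ Φ`. Sources: ReattoChester1967, Reatto1969,
McMillan1965, LSSY2005, PeilenSerfaty2025. -/
theorem stub_shadowDominationReference :
    ∀ v : ℝ → ENNReal, BoseGas.IsRepulsiveFiniteRange v →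
    ∃ ρ₀ : ℝ, 0 < ρ₀ ∧ ∀ ρ : ℝ, 0 < ρ → ρ < ρ₀ → ∀ ℓ : ℝ, 0 < ℓ → ∃ A : ℝ,
    ∀ᶠ n : ℕ in Filter.atTop,
      ∀ (L : ℝ), L = BoseGas.sideLength ρ (n + 1) →
      ∀ (m : ℕ), m = ⌊L / ℓ⌋₊ →
      ∀ (a : ℝ), a = (BoseGas.scatteringLength v).toReal →
      ∀ (b : ℝ), b = 2 * Real.pi ^ (-(3 / 2 : ℝ)) * (a / ρ) ^ (1 / 2 : ℝ) →
      ∀ (η : ℝ), η = max ((8 * Real.pi * ρ * a) ^ (-(1 / 2 : ℝ))) (ρ ^ (-(1 / 3 : ℝ))) →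
      ∀ (g : BoseGas.Space → ℝ), g = (fun x =>
        2 * Real.pi ^ (3 / 2 : ℝ) * ∫ t in Set.Ioi (η ^ 2), t ^ (-(1 / 2 : ℝ)) *
          ((∑' mm : Fin 3 → ℤ, Literature.Analysis.UnboundedOperators.heatKernel t
            (x - BoseGas.latticeVec L mm)) - 1 / L ^ 3)) →
      ∀ (H : BoseGas.Config n → ℝ), H = (fun X => ∑ i : Fin n, ∑ j : Fin n with i < j, g (X i - X j)) →
      ∀ δ : ENNReal, 0 < δ →
      ∃ Φ : BoseGas.TrialState (n + 1) L,
        BoseGas.energy v Φ ≤ BoseGas.groundStateEnergy v (n + 1) L + δ ∧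
        (∀ X, Φ.ψ X = (‖Φ.ψ X‖ : ℂ)) ∧
        (m : ENNReal) ^ 3 * ∫⁻ X : Fin n → EuclideanSpace ℝ (Fin 3),
            ((∑ k : Fin 3 → Fin m,
                (∫⁻ y in {y : EuclideanSpace ℝ (Fin 3) |
                    ∀ i, y i ∈ Set.Ico ((k i : ℝ) * (L / m)) (((k i : ℝ) + 1) * (L / m))},
                  (‖Φ.ψ (Matrix.vecCons y X)‖₊ : ENNReal) ^ 2) ^ 2) /
              (∫⁻ y, (‖Φ.ψ (Matrix.vecCons y X)‖₊ : ENNReal) ^ 2))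
          ≤ ENNReal.ofReal A * (1 +
            ⨆ y : BoseGas.Space,
              (∫⁻ X in BoseGas.cellN n L,
                  ENNReal.ofReal (Real.exp (-(b * H X) - 2 * b * ∑ j : Fin n, g (y - X j)))) /
              (∫⁻ X in BoseGas.cellN n L, ENNReal.ofReal (Real.exp (-(b * H X))))) := by
  sorry

/-- **S4 — the classical engine in the Bose corner (uniform `θ = 2` cavity-field moment of the shadow gas along the
dictionary).** For admissible `v` and small `ρ` there is `C` with `S_n ≤ C` eventually in `n` (`S_n` as in S3, box
side `L = ((n+1)/ρ)^{1/3}`). Case `a = 0`: `b = 0`, `S_n ≤ 1`. Case `a > 0`: this is route item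
stmt-AtomisticToContinuum-12841 `RieszShadowFieldMoment` specialised to `θ = 2` and the corner point
`(b, η)(ρ, a)`: Kac corner `(n/L³)η³ ≥ (n/(n+1))·ρξ³ ≥ 1` for `ρ ≤ (4(8πa)³)⁻¹`, coupling corner
`b(n/L³)^{2/3} ≤ 2π^{-3/2}a^{1/2}ρ^{1/6} < Γ₀` for `ρ < (Γ₀/(2π^{-3/2}a^{1/2}+1))⁶`, `η ≤ L` eventually
(`BoseGas.tendsto_sideLength_atTop`) — arithmetic kernel-checked verbatim inside
`coarseGrainedReverseHolder_of_fieldMomentDomination` (Theorems/BECRieszReverseHolderBoseRieszMembershipGlue.lean),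
so S4 follows from item 12841 by extraction (size S given the item; the item itself is difficulty L: uniformity in
`L` of exponential moments of a non-integrable-kernel gas with strongly coupled `k → 0` modes, PeilenSerfaty2025-type
local laws without confinement). Sources: PeilenSerfaty2025 (arXiv:2511.18623), ArmstrongSerfaty2021,
LebleSerfaty2017, arXiv:2209.00587. -/
theorem stub_shadowMomentBoseCorner :
    ∀ v : ℝ → ENNReal, BoseGas.IsRepulsiveFiniteRange v →
    ∃ ρ₀ : ℝ, 0 < ρ₀ ∧ ∀ ρ : ℝ, 0 < ρ → ρ < ρ₀ → ∃ C : ℝ,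
    ∀ᶠ n : ℕ in Filter.atTop,
      ∀ (L : ℝ), L = BoseGas.sideLength ρ (n + 1) →
      ∀ (a : ℝ), a = (BoseGas.scatteringLength v).toReal →
      ∀ (b : ℝ), b = 2 * Real.pi ^ (-(3 / 2 : ℝ)) * (a / ρ) ^ (1 / 2 : ℝ) →
      ∀ (η : ℝ), η = max ((8 * Real.pi * ρ * a) ^ (-(1 / 2 : ℝ))) (ρ ^ (-(1 / 3 : ℝ))) →
      ∀ (g : BoseGas.Space → ℝ), g = (fun x =>
        2 * Real.pi ^ (3 / 2 : ℝ) * ∫ t in Set.Ioi (η ^ 2), t ^ (-(1 / 2 : ℝ)) *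
          ((∑' mm : Fin 3 → ℤ, Literature.Analysis.UnboundedOperators.heatKernel t
            (x - BoseGas.latticeVec L mm)) - 1 / L ^ 3)) →
      ∀ (H : BoseGas.Config n → ℝ), H = (fun X => ∑ i : Fin n, ∑ j : Fin n with i < j, g (X i - X j)) →
      (⨆ y : BoseGas.Space,
        (∫⁻ X in BoseGas.cellN n L,
            ENNReal.ofReal (Real.exp (-(b * H X) - 2 * b * ∑ j : Fin n, g (y - X j)))) /
        (∫⁻ X in BoseGas.cellN n L, ENNReal.ofReal (Real.exp (-(b * H X)))))
        ≤ ENNReal.ofReal C := by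
  sorry

/-! ## Composition (sorry-free implication + the registered skeleton theorem concluding the crux BY NAME) -/

/-- The implication form of the skeleton: `S1 → S2 → S3 → S4 → CoarseGrainedReverseHolder`, stub statements verbatim
(S2 = `GroundStateRigidity` by name). Proved below WITHOUT sorry (`birthImplication_holds`, axioms propext /
Classical.choice / Quot.sound): this is the BC3 certificate that the four stubs compose to the crux. -/
def BirthImplication : Prop :=
    (∀ (n : ℕ) (L ℓ η : ℝ), 0 ≤ η →
    ∀ (Ψ Φ : BoseGas.TrialState (n + 1) L) (c : ℂ), ‖c‖ = 1 →
      ∫⁻ X, (‖Ψ.ψ X - c * Φ.ψ X‖₊ : ENNReal) ^ 2 ≤ ENNReal.ofReal (η ^ 2) →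
      ∀ (m : ℕ), m = ⌊L / ℓ⌋₊ →
      (m : ENNReal) ^ 3 * ∫⁻ X : Fin n → EuclideanSpace ℝ (Fin 3),
          ((∑ k : Fin 3 → Fin m,
              (∫⁻ y in {y : EuclideanSpace ℝ (Fin 3) |
                  ∀ i, y i ∈ Set.Ico ((k i : ℝ) * (L / m)) (((k i : ℝ) + 1) * (L / m))},
                (‖Ψ.ψ (Matrix.vecCons y X)‖₊ : ENNReal) ^ 2) ^ 2) /
            (∫⁻ y, (‖Ψ.ψ (Matrix.vecCons y X)‖₊ : ENNReal) ^ 2))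
        ≤ ((m : ENNReal) ^ 3 * ∫⁻ X : Fin n → EuclideanSpace ℝ (Fin 3),
              ((∑ k : Fin 3 → Fin m,
                  (∫⁻ y in {y : EuclideanSpace ℝ (Fin 3) |
                      ∀ i, y i ∈ Set.Ico ((k i : ℝ) * (L / m)) (((k i : ℝ) + 1) * (L / m))},
                    (‖Φ.ψ (Matrix.vecCons y X)‖₊ : ENNReal) ^ 2) ^ 2) /
                (∫⁻ y, (‖Φ.ψ (Matrix.vecCons y X)‖₊ : ENNReal) ^ 2)))
          + ENNReal.ofReal (6 * (m : ℝ) ^ 3 * η)) →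
    GroundStateRigidity →
    (∀ v : ℝ → ENNReal, BoseGas.IsRepulsiveFiniteRange v →
    ∃ ρ₀ : ℝ, 0 < ρ₀ ∧ ∀ ρ : ℝ, 0 < ρ → ρ < ρ₀ → ∀ ℓ : ℝ, 0 < ℓ → ∃ A : ℝ,
    ∀ᶠ n : ℕ in Filter.atTop,
      ∀ (L : ℝ), L = BoseGas.sideLength ρ (n + 1) →
      ∀ (m : ℕ), m = ⌊L / ℓ⌋₊ →
      ∀ (a : ℝ), a = (BoseGas.scatteringLength v).toReal →
      ∀ (b : ℝ), b = 2 * Real.pi ^ (-(3 / 2 : ℝ)) * (a / ρ) ^ (1 / 2 : ℝ) →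
      ∀ (η : ℝ), η = max ((8 * Real.pi * ρ * a) ^ (-(1 / 2 : ℝ))) (ρ ^ (-(1 / 3 : ℝ))) →
      ∀ (g : BoseGas.Space → ℝ), g = (fun x =>
        2 * Real.pi ^ (3 / 2 : ℝ) * ∫ t in Set.Ioi (η ^ 2), t ^ (-(1 / 2 : ℝ)) *
          ((∑' mm : Fin 3 → ℤ, Literature.Analysis.UnboundedOperators.heatKernel t
            (x - BoseGas.latticeVec L mm)) - 1 / L ^ 3)) →
      ∀ (H : BoseGas.Config n → ℝ), H = (fun X => ∑ i : Fin n, ∑ j : Fin n with i < j, g (X i - X j)) →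
      ∀ δ : ENNReal, 0 < δ →
      ∃ Φ : BoseGas.TrialState (n + 1) L,
        BoseGas.energy v Φ ≤ BoseGas.groundStateEnergy v (n + 1) L + δ ∧
        (∀ X, Φ.ψ X = (‖Φ.ψ X‖ : ℂ)) ∧
        (m : ENNReal) ^ 3 * ∫⁻ X : Fin n → EuclideanSpace ℝ (Fin 3),
            ((∑ k : Fin 3 → Fin m,
                (∫⁻ y in {y : EuclideanSpace ℝ (Fin 3) |
                    ∀ i, y i ∈ Set.Ico ((k i : ℝ) * (L / m)) (((k i : ℝ) + 1) * (L / m))},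
                  (‖Φ.ψ (Matrix.vecCons y X)‖₊ : ENNReal) ^ 2) ^ 2) /
              (∫⁻ y, (‖Φ.ψ (Matrix.vecCons y X)‖₊ : ENNReal) ^ 2))
          ≤ ENNReal.ofReal A * (1 +
            ⨆ y : BoseGas.Space,
              (∫⁻ X in BoseGas.cellN n L,
                  ENNReal.ofReal (Real.exp (-(b * H X) - 2 * b * ∑ j : Fin n, g (y - X j)))) /
              (∫⁻ X in BoseGas.cellN n L, ENNReal.ofReal (Real.exp (-(b * H X)))))) →
    (∀ v : ℝ → ENNReal, BoseGas.IsRepulsiveFiniteRange v →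
    ∃ ρ₀ : ℝ, 0 < ρ₀ ∧ ∀ ρ : ℝ, 0 < ρ → ρ < ρ₀ → ∃ C : ℝ,
    ∀ᶠ n : ℕ in Filter.atTop,
      ∀ (L : ℝ), L = BoseGas.sideLength ρ (n + 1) →
      ∀ (a : ℝ), a = (BoseGas.scatteringLength v).toReal →
      ∀ (b : ℝ), b = 2 * Real.pi ^ (-(3 / 2 : ℝ)) * (a / ρ) ^ (1 / 2 : ℝ) →
      ∀ (η : ℝ), η = max ((8 * Real.pi * ρ * a) ^ (-(1 / 2 : ℝ))) (ρ ^ (-(1 / 3 : ℝ))) →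
      ∀ (g : BoseGas.Space → ℝ), g = (fun x =>
        2 * Real.pi ^ (3 / 2 : ℝ) * ∫ t in Set.Ioi (η ^ 2), t ^ (-(1 / 2 : ℝ)) *
          ((∑' mm : Fin 3 → ℤ, Literature.Analysis.UnboundedOperators.heatKernel t
            (x - BoseGas.latticeVec L mm)) - 1 / L ^ 3)) →
      ∀ (H : BoseGas.Config n → ℝ), H = (fun X => ∑ i : Fin n, ∑ j : Fin n with i < j, g (X i - X j)) →
      (⨆ y : BoseGas.Space,
        (∫⁻ X in BoseGas.cellN n L,
            ENNReal.ofReal (Real.exp (-(b * H X) - 2 * b * ∑ j : Fin n, g (y - X j)))) /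
        (∫⁻ X in BoseGas.cellN n L, ENNReal.ofReal (Real.exp (-(b * H X)))))
        ≤ ENNReal.ofReal C) →
    CoarseGrainedReverseHolder

/-- **The four stubs imply the crux** (pure logic + `ℝ≥0∞` bookkeeping: thresholds `min`, constant
`max A 0 · (1 + max C 0) + 1`, eventualities intersected after shifting rigidity to `N = n+1`, tolerance
`η₀ = 1/(6m³+6)` chosen after `n`, `δ` from rigidity, reference state from S3, engine bound from S4, transfer by S1).
Sorry-free. -/
theorem birthImplication_holds : BirthImplication := by
  intro hcont hrig hdom heng v hv
  obtain ⟨ρ₁, hρ₁, h1⟩ := hrig v hv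
  obtain ⟨ρ₂, hρ₂, h2⟩ := hdom v hv
  obtain ⟨ρ₃, hρ₃, h3⟩ := heng v hv
  refine ⟨min ρ₁ (min ρ₂ ρ₃), lt_min hρ₁ (lt_min hρ₂ hρ₃), fun ρ hρ hρlt ℓ hℓ => ?_⟩
  have hρ₁' : ρ < ρ₁ := hρlt.trans_le (min_le_left _ _)
  have hρ₂' : ρ < ρ₂ := (hρlt.trans_le (min_le_right _ _)).trans_le (min_le_left _ _)
  have hρ₃' : ρ < ρ₃ := (hρlt.trans_le (min_le_right _ _)).trans_le (min_le_right _ _)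
  obtain ⟨A, hA⟩ := h2 ρ hρ hρ₂' ℓ hℓ
  obtain ⟨C, hC⟩ := h3 ρ hρ hρ₃'
  refine ⟨max A 0 * (1 + max C 0) + 1, ?_⟩
  -- rigidity, shifted to `N = n + 1`
  have h1' : ∀ᶠ n : ℕ in Filter.atTop, ∀ η : ℝ, 0 < η → ∃ δ : ENNReal, 0 < δ ∧
      ∀ Ψ Φ : BoseGas.TrialState (n + 1) (BoseGas.sideLength ρ (n + 1)),
        BoseGas.energy v Ψ ≤ BoseGas.groundStateEnergy v (n + 1) (BoseGas.sideLength ρ (n + 1)) + δ →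
        BoseGas.energy v Φ ≤ BoseGas.groundStateEnergy v (n + 1) (BoseGas.sideLength ρ (n + 1)) + δ →
        ∃ c : ℂ, ‖c‖ = 1 ∧
          ∫⁻ X, (‖Ψ.ψ X - c * Φ.ψ X‖₊ : ENNReal) ^ 2 ≤ ENNReal.ofReal η :=
    (tendsto_add_atTop_nat 1).eventually (h1 ρ hρ hρ₁')
  filter_upwards [h1', hA, hC] with n hRn hAn hCn
  -- the Lipschitz tolerance `η₀ = 1 / (6 m³ + 6)` at this `n`
  have hK : (0 : ℝ) < 6 * ((⌊BoseGas.sideLength ρ (n + 1) / ℓ⌋₊ : ℕ) : ℝ) ^ 3 + 6 := by positivity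
  have hη₀ : (0 : ℝ) < 1 / (6 * ((⌊BoseGas.sideLength ρ (n + 1) / ℓ⌋₊ : ℕ) : ℝ) ^ 3 + 6) := by positivity
  obtain ⟨δ, hδ, hδP⟩ :=
    hRn ((1 / (6 * ((⌊BoseGas.sideLength ρ (n + 1) / ℓ⌋₊ : ℕ) : ℝ) ^ 3 + 6)) ^ 2) (by positivity)
  -- the reference state at this `δ` (dictionary binders instantiated by `rfl`)
  obtain ⟨Φ, hΦE, hΦpos, hΦF⟩ := hAn _ rfl _ rfl _ rfl _ rfl _ rfl _ rfl _ rfl δ hδ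
  have hCn' := hCn _ rfl _ rfl _ rfl _ rfl _ rfl _ rfl
  refine ⟨δ, hδ, fun Ψ hΨE hΨpos => ?_⟩
  obtain ⟨c, hc, hclose⟩ := hδP Ψ Φ hΨE hΦE
  have key := hcont n (BoseGas.sideLength ρ (n + 1)) ℓ
    (1 / (6 * ((⌊BoseGas.sideLength ρ (n + 1) / ℓ⌋₊ : ℕ) : ℝ) ^ 3 + 6)) hη₀.le Ψ Φ c hc hclose _ rfl
  dsimp only at hΦF hCn' ⊢
  refine key.trans ?_
  have hreal : 6 * ((⌊BoseGas.sideLength ρ (n + 1) / ℓ⌋₊ : ℕ) : ℝ) ^ 3 *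
      (1 / (6 * ((⌊BoseGas.sideLength ρ (n + 1) / ℓ⌋₊ : ℕ) : ℝ) ^ 3 + 6)) ≤ 1 :=
    calc 6 * ((⌊BoseGas.sideLength ρ (n + 1) / ℓ⌋₊ : ℕ) : ℝ) ^ 3 *
          (1 / (6 * ((⌊BoseGas.sideLength ρ (n + 1) / ℓ⌋₊ : ℕ) : ℝ) ^ 3 + 6))
          ≤ (6 * ((⌊BoseGas.sideLength ρ (n + 1) / ℓ⌋₊ : ℕ) : ℝ) ^ 3 + 6) *
            (1 / (6 * ((⌊BoseGas.sideLength ρ (n + 1) / ℓ⌋₊ : ℕ) : ℝ) ^ 3 + 6)) :=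
            mul_le_mul_of_nonneg_right (by linarith) hη₀.le
      _ = 1 := mul_one_div_cancel hK.ne'
  calc _ ≤ ENNReal.ofReal (max A 0) * (1 + ENNReal.ofReal (max C 0)) + ENNReal.ofReal 1 := by
        refine add_le_add (hΦF.trans ?_) (ENNReal.ofReal_le_ofReal hreal)
        gcongr ENNReal.ofReal ?_ * (1 + ?_)
        · exact le_max_left _ _
        · exact hCn'.trans (ENNReal.ofReal_le_ofReal (le_max_left _ _))
    _ = ENNReal.ofReal (max A 0 * (1 + max C 0) + 1) := by
        rw [ENNReal.ofReal_add (by positivity) zero_le_one, ENNReal.ofReal_mul (le_max_right _ _),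
          ENNReal.ofReal_add zero_le_one (le_max_right _ _), ENNReal.ofReal_one]

/-- **Registered skeleton theorem** — concludes the crux `CoarseGrainedReverseHolder` BY NAME from the four declared
stubs (the only `sorry`s of this file live inside `stub_*`; this declaration uses none directly). -/
theorem CoarseGrainedReverseHolder_of : CoarseGrainedReverseHolder :=
  birthImplication_holds stub_sliceFunctionalLipschitz stub_groundStateRigidity
    stub_shadowDominationReference stub_shadowMomentBoseCorner

end Summit.AtomisticToContinuum.BoseEinsteinCondensation.Cruxes.CoarseGrainedReverseHolder.Birth

end
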